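import Summits.ValiantsHypothesis.ValiantsHypothesis.Theorems.LacunarySymmetroidMatrixDescartesVLawNormalForm

/-!
# `MatrixDescartes` (stmt-ValiantsHypothesis-18050), line `Lift` — Lemma FULL of `VLAW-PROOF.md` in the KERNEL, part 2:
# the Gram (Hadamard–Stieltjes) decomposition of the compressed pencil and the STAR CORE LEMMA

HONEST FRAMING.  Cell `pub-symmetroid`, seat `val-sym-mdr-p2` (gen 2); helper `--supports` the crux
`Theses.LacunarySymmetroid.MatrixDescartes`, NO closure claim.  Second half of the kernel proof of Lemma FULL (paper proof
`VLAW-PROOF.md` §2, predecessor g0; desk R1345); part 1 = `…VLawNormalForm.lean` (finite algebra, vanishing lemmas,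
Stieltjes integrals), analysis = `…VLawStieltjes.lean`.  Consumed by `…FanLaw.lean` (the V-law `stub_vLaw` and the fan
law).  Nothing here bears on `stub_twoSided`, the crux in its window, `DoorA26`/`DoorA34`, or `VP ≠ VNP`.

THE STAR CORE LEMMA (`VLawCore.core_pos`).  Data: a real symmetric `J`, positive semidefinite `P` (the LONE letter,
gap `a > 0`) and `Q l` (`l : κ`, the CROWDED side, gaps `0 < b l < a`, `n l + b l + 1 = a`), and the H-form
`H(u) = J + (u^a)⁻¹ • P + ∑ l, u^(b l) • Q l` (`= t^{-e} ·` the pencil, `u = t` for a lone LOWER letter, `u = t⁻¹` for a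
lone UPPER letter).  If `v j` are kernel vectors of `H(u j)` at pairwise distinct nodes `u j > 0`, `s > 0` is not a node,
every node's Rayleigh slope points towards `s` — `0 ≤ (s − u j)·σ j`,
`σ j = −a (u j^a)⁻¹ v_jᵀPv_j + ∑ l, b l·(u j)^(b l) v_jᵀQ_l v_j` — and no `v j` is killed by all of `J, P, Q l`, THEN the
quadratic form of `H(s)` is STRICTLY positive at every nonzero combination `∑ j, c j • v j`.
PROOF.  Entrywise Stieltjes form of `M_ij = v_iᵀH(s)v_j` (`entry_offdiag`, `entry_diag`, from part 1), bookkeeping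
(`rearrange`) ⇒ GRAM DECOMPOSITION `∑_{ij} c_i c_j M_ij = ∑_l C_l⁻¹ ∫_{ρ>0} ρ^{n_l} r_t(ρ)·(y_ρᵀ Q_l y_ρ) dρ + ∑_i c_i^2·slack_i`
with `y_ρ = ∑_i c_i (t − w_i) r_{w_i}(ρ) • v_i`, `slack_i = (t − w_i)(P̂_ii − ∑_l (b_l/a) u_i^{a+b_l} Q̂^l_ii) ≥ 0` by STAR
(`weight_sign`); strictness: vanishing integrals force `Q_l y_ρ = 0` for all `ρ > 0`, partial fractions force
`Q_l v_i = 0` on the support of `c`, the slack forces `P v_i = 0`, the kernel relation `J v_i = 0` — contradicting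
nondegeneracy.  [folklore] Löwner/Stieltjes kernel positivity; elementary given parts 1 and the analysis layer.
-/

-- layout Summits/ValiantsHypothesis/ValiantsHypothesis forces the duplicated namespace component
set_option linter.dupNamespace false

namespace Summit.ValiantsHypothesis.ValiantsHypothesis.Theorems.LacunarySymmetroidMatrixDescartes

open MeasureTheory Set Filter Topology Matrix Finset
open scoped BigOperators
open VLawNormalForm

namespace VLawCore

/-! ## The entries of the compressed matrix `M_ij = v_iᵀ H(s) v_j` in Stieltjes form -/

section Entries

variable {ι : Type*} [Fintype ι] {κ : Type*} [Fintype κ]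

/-- **Off-diagonal entry.**  For distinct nodes `u i ≠ u j`,
`M_ij = ∑ l, Q̂^l_ij · (D_i D_j K^l_ij / C_l)` with `D_i = (s^a)⁻¹ − (u_i^a)⁻¹`,
`K^l_ij = ∫ ρ^{n_l} r_i r_j r_t`, `C_l = ∫ ρ^{n_l}/(1+ρ^a)`. [folklore] -/
theorem entry_offdiag {a : ℕ} (ha : 0 < a) {b n : κ → ℕ} (hnb : ∀ l, n l + b l + 1 = a)
    (hb : ∀ l, 0 < b l) {J P : Matrix ι ι ℝ} {Q : κ → Matrix ι ι ℝ} (hJ : J.IsSymm) (hP : P.IsSymm)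
    (hQ : ∀ l, (Q l).IsSymm) {ui uj s : ℝ} (hui : 0 < ui) (huj : 0 < uj) (hs : 0 < s) (hij : ui ≠ uj)
    {vi vj : ι → ℝ} (hi : (J + (ui ^ a)⁻¹ • P + ∑ l, ui ^ (b l) • Q l) *ᵥ vi = 0)
    (hj : (J + (uj ^ a)⁻¹ • P + ∑ l, uj ^ (b l) • Q l) *ᵥ vj = 0) :
    vi ⬝ᵥ ((J + (s ^ a)⁻¹ • P + ∑ l, s ^ (b l) • Q l) *ᵥ vj)
      = ∑ l, (vi ⬝ᵥ (Q l *ᵥ vj)) * (((s ^ a)⁻¹ - (ui ^ a)⁻¹) * ((s ^ a)⁻¹ - (uj ^ a)⁻¹)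
          * (∫ ρ in Ioi (0:ℝ), ρ ^ (n l) / ((ui ^ a)⁻¹ + ρ ^ a) * (((uj ^ a)⁻¹ + ρ ^ a)⁻¹ * ((s ^ a)⁻¹ + ρ ^ a)⁻¹))
          / ∫ ρ in Ioi (0:ℝ), ρ ^ (n l) / (1 + ρ ^ a)) := by
  have hna : ∀ l, n l + 2 ≤ a := fun l => by have := hnb l; have := hb l; omega
  have hC : ∀ l, (∫ ρ in Ioi (0:ℝ), ρ ^ (n l) / (1 + ρ ^ a)) ≠ 0 :=
    fun l => (VLawStieltjes.stieltjesConst_pos (hna l)).ne'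
  have hpq : (uj ^ a)⁻¹ - (ui ^ a)⁻¹ ≠ 0 := by
    intro h
    exact hij ((pow_left_inj₀ hui.le huj.le ha.ne').1 (inv_injective (sub_eq_zero.1 h).symm))
  have hoff := offdiag_identity hJ hP hQ (ui ^ a)⁻¹ (uj ^ a)⁻¹ (s ^ a)⁻¹ (fun l => ui ^ (b l))
    (fun l => uj ^ (b l)) (fun l => s ^ (b l)) hi hj
  refine mul_left_cancel₀ hpq ?_
  rw [hoff, Finset.mul_sum]
  refine Finset.sum_congr rfl fun l _ => ?_
  have hl := offdiag_integral (hna l) (inv_pos.2 (pow_pos hui a)) (inv_pos.2 (pow_pos huj a))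
    (inv_pos.2 (pow_pos hs a)) (VLawStieltjes.integral_stieltjes_one (hnb l) hui)
    (VLawStieltjes.integral_stieltjes_one (hnb l) huj) (VLawStieltjes.integral_stieltjes_one (hnb l) hs)
  set Kl := ∫ ρ in Ioi (0:ℝ), ρ ^ (n l) / ((ui ^ a)⁻¹ + ρ ^ a) * (((uj ^ a)⁻¹ + ρ ^ a)⁻¹ * ((s ^ a)⁻¹ + ρ ^ a)⁻¹)
    with hKl
  set Cl := ∫ ρ in Ioi (0:ℝ), ρ ^ (n l) / (1 + ρ ^ a) with hCl
  have hCl' : Cl ≠ 0 := hC l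
  rw [mul_div_assoc', mul_div_assoc', eq_div_iff hCl']
  linear_combination (-(vi ⬝ᵥ (Q l *ᵥ vj))) * hl

/-- **Diagonal entry.**  `M_ii = ∑ l, Q̂^l_ii · (D_i^2 K^l_ii / C_l) + slack_i` with
`slack_i = D_i · (P̂_ii − ∑ l, (b_l/a) u_i^{a+b_l} Q̂^l_ii)`. [folklore] -/
theorem entry_diag {a : ℕ} {b n : κ → ℕ} (hnb : ∀ l, n l + b l + 1 = a) (hb : ∀ l, 0 < b l)
    (J P : Matrix ι ι ℝ) (Q : κ → Matrix ι ι ℝ) {ui s : ℝ} (hui : 0 < ui) (hs : 0 < s) {vi : ι → ℝ}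
    (hi : (J + (ui ^ a)⁻¹ • P + ∑ l, ui ^ (b l) • Q l) *ᵥ vi = 0) :
    vi ⬝ᵥ ((J + (s ^ a)⁻¹ • P + ∑ l, s ^ (b l) • Q l) *ᵥ vi)
      = (∑ l, (vi ⬝ᵥ (Q l *ᵥ vi)) * (((s ^ a)⁻¹ - (ui ^ a)⁻¹) * ((s ^ a)⁻¹ - (ui ^ a)⁻¹)
          * (∫ ρ in Ioi (0:ℝ), ρ ^ (n l) / ((ui ^ a)⁻¹ + ρ ^ a) * (((ui ^ a)⁻¹ + ρ ^ a)⁻¹ * ((s ^ a)⁻¹ + ρ ^ a)⁻¹))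
          / ∫ ρ in Ioi (0:ℝ), ρ ^ (n l) / (1 + ρ ^ a)))
        + ((s ^ a)⁻¹ - (ui ^ a)⁻¹) * (vi ⬝ᵥ (P *ᵥ vi)
            - ∑ l, ((b l : ℝ) / a) * ui ^ (a + b l) * (vi ⬝ᵥ (Q l *ᵥ vi))) := by
  have hna : ∀ l, n l + 2 ≤ a := fun l => by have := hnb l; have := hb l; omega
  have hC : ∀ l, (∫ ρ in Ioi (0:ℝ), ρ ^ (n l) / (1 + ρ ^ a)) ≠ 0 :=
    fun l => (VLawStieltjes.stieltjesConst_pos (hna l)).ne'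
  rw [diag_identity J P Q (ui ^ a)⁻¹ (s ^ a)⁻¹ (fun l => ui ^ (b l)) (fun l => s ^ (b l)) hi]
  have hK : ∀ l, ((s ^ a)⁻¹ - (ui ^ a)⁻¹) * ((s ^ a)⁻¹ - (ui ^ a)⁻¹)
      * (∫ ρ in Ioi (0:ℝ), ρ ^ (n l) / ((ui ^ a)⁻¹ + ρ ^ a) * (((ui ^ a)⁻¹ + ρ ^ a)⁻¹ * ((s ^ a)⁻¹ + ρ ^ a)⁻¹))
      / (∫ ρ in Ioi (0:ℝ), ρ ^ (n l) / (1 + ρ ^ a))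
      = s ^ (b l) - ui ^ (b l) + ((s ^ a)⁻¹ - (ui ^ a)⁻¹) * (((b l : ℝ) / a) * ui ^ (a + b l)) := by
    intro l
    have hl := diag_integral (hna l) (inv_pos.2 (pow_pos hui a)) (inv_pos.2 (pow_pos hs a))
      (VLawStieltjes.integral_stieltjes_one (hnb l) hui) (VLawStieltjes.integral_stieltjes_one (hnb l) hs)
      (VLawStieltjes.integral_stieltjes_sq (hnb l) (hb l) hui)
    set Kl := ∫ ρ in Ioi (0:ℝ), ρ ^ (n l) / ((ui ^ a)⁻¹ + ρ ^ a) * (((ui ^ a)⁻¹ + ρ ^ a)⁻¹ * ((s ^ a)⁻¹ + ρ ^ a)⁻¹)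
      with hKl
    set Cl := ∫ ρ in Ioi (0:ℝ), ρ ^ (n l) / (1 + ρ ^ a) with hCl
    have hCl' : Cl ≠ 0 := hC l
    rw [div_eq_iff hCl']
    linear_combination hl
  simp_rw [hK]
  simp only [mul_add, mul_sub, Finset.sum_add_distrib, Finset.mul_sum]
  have e : ∀ l, (vi ⬝ᵥ (Q l *ᵥ vi)) * (((s ^ a)⁻¹ - (ui ^ a)⁻¹) * (((b l : ℝ) / a) * ui ^ (a + b l)))
      = ((s ^ a)⁻¹ - (ui ^ a)⁻¹) * (((b l : ℝ) / a) * ui ^ (a + b l) * (vi ⬝ᵥ (Q l *ᵥ vi))) := fun l => by ring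
  simp_rw [e, sub_mul, mul_comm (vi ⬝ᵥ (Q _ *ᵥ vi))]
  ring

/-- Rearrangement of the double sum of the Gram decomposition (pure bookkeeping). [folklore] -/
theorem rearrange {k : ℕ} (c D sl : Fin k → ℝ) (Qh K : κ → Fin k → Fin k → ℝ) (C : κ → ℝ) :
    ∑ i, ∑ j, c i * c j * ((∑ l, Qh l i j * (D i * D j * K l i j / C l)) + if i = j then sl i else 0)
      = (∑ l, (C l)⁻¹ * ∑ i, ∑ j, (c i * D i) * (c j * D j) * Qh l i j * K l i j)
        + ∑ i, c i ^ 2 * sl i := by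
  classical
  have h1 : ∀ i j, c i * c j * (∑ l, Qh l i j * (D i * D j * K l i j / C l))
      = ∑ l, (C l)⁻¹ * ((c i * D i) * (c j * D j) * Qh l i j * K l i j) := by
    intro i j
    rw [Finset.mul_sum]
    refine Finset.sum_congr rfl fun l _ => ?_
    rw [div_eq_mul_inv]
    ring
  simp_rw [mul_add, Finset.sum_add_distrib, h1, mul_ite, mul_zero, Finset.sum_ite_eq, Finset.mem_univ,
    if_true]
  congr 1
  · calc ∑ i, ∑ j, ∑ l, (C l)⁻¹ * ((c i * D i) * (c j * D j) * Qh l i j * K l i j)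
        = ∑ i, ∑ l, ∑ j, (C l)⁻¹ * ((c i * D i) * (c j * D j) * Qh l i j * K l i j) :=
          Finset.sum_congr rfl fun i _ => Finset.sum_comm
      _ = ∑ l, ∑ i, ∑ j, (C l)⁻¹ * ((c i * D i) * (c j * D j) * Qh l i j * K l i j) := Finset.sum_comm
      _ = ∑ l, (C l)⁻¹ * ∑ i, ∑ j, (c i * D i) * (c j * D j) * Qh l i j * K l i j := by
          simp_rw [Finset.mul_sum]
  · refine Finset.sum_congr rfl fun i _ => ?_
    ring

end Entries

/-! ## The STAR core lemma -/

section Core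

variable {ι : Type*} [Fintype ι] {κ : Type*} [Fintype κ]

/-- Slope-sign transfer to the Stieltjes weights: `0 ≤ (s − u)·σ`, `s, u > 0` give
`0 ≤ ((u^a)⁻¹ − (s^a)⁻¹)·σ` (any `a`). [folklore] -/
theorem weight_sign {a : ℕ} {s u σ : ℝ} (hs : 0 < s) (hu : 0 < u) (h : 0 ≤ (s - u) * σ) :
    0 ≤ ((u ^ a)⁻¹ - (s ^ a)⁻¹) * σ := by
  rcases lt_trichotomy s u with hlt | heq | hgt
  · have hσ : σ ≤ 0 := by
      by_contra hσ
      push Not at hσ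
      nlinarith
    have hle : (u ^ a)⁻¹ - (s ^ a)⁻¹ ≤ 0 :=
      sub_nonpos.2 (inv_anti₀ (pow_pos hs a) (pow_le_pow_left₀ hs.le hlt.le a))
    exact mul_nonneg_of_nonpos_of_nonpos hle hσ
  · subst heq; simp
  · have hσ : 0 ≤ σ := by
      by_contra hσ
      push Not at hσ
      nlinarith
    have hle : 0 ≤ (u ^ a)⁻¹ - (s ^ a)⁻¹ :=
      sub_nonneg.2 (inv_anti₀ (pow_pos hu a) (pow_le_pow_left₀ hu.le hgt.le a))
    exact mul_nonneg hle hσ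

/-- The kernel integrand `∑_{ij} e_i e_j Q̂_ij ρ^n r_i r_j r_t` is continuous on `(0, ∞)`. [folklore] -/
theorem continuousOn_kernelSum {k : ℕ} (n a : ℕ) {w : Fin k → ℝ} (hw : ∀ i, 0 < w i) {t : ℝ} (ht : 0 < t)
    (Qh : Fin k → Fin k → ℝ) (e : Fin k → ℝ) :
    ContinuousOn (fun ρ : ℝ => ∑ i, ∑ j, e i * e j * Qh i j
        * (ρ ^ n / (w i + ρ ^ a) * ((w j + ρ ^ a)⁻¹ * (t + ρ ^ a)⁻¹))) (Ioi 0) := by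
  refine continuousOn_finsetSum _ fun i _ => continuousOn_finsetSum _ fun j _ => ?_
  refine ContinuousOn.mul continuousOn_const ?_
  exact ((VLawStieltjes.continuousOn_stieltjes n a (hw i)).mono Ioi_subset_Ici_self).mul
    (((VLawStieltjes.continuousOn_inv_den a (hw j)).mono Ioi_subset_Ici_self).mul
      ((VLawStieltjes.continuousOn_inv_den a ht).mono Ioi_subset_Ici_self))

/-- **STAR CORE LEMMA** (Lemma FULL of `VLAW-PROOF.md`, fan form).  See the module docstring.  `a > 0` is the gap of
the lone letter `P`, `b l < a` (`n l + b l + 1 = a`) the gaps of the crowded letters `Q l`; `u j > 0` pairwise distinct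
nodes with kernel vectors `v j` of `H(u j) = J + (u_j^a)⁻¹ P + ∑ l, u_j^{b l} Q_l`; `s > 0` not a node; STAR slope
condition `0 ≤ (s − u_j)·σ_j`; nondegeneracy: no `v j` is killed by `J`, `P` and every `Q l`.  Conclusion: the quadratic
form of `H(s)` is positive at every nonzero combination of the `v j`. [folklore] -/
theorem core_pos [DecidableEq ι] (a : ℕ) (ha : 0 < a) (b n : κ → ℕ) (hnb : ∀ l, n l + b l + 1 = a)
    (hb : ∀ l, 0 < b l) (J P : Matrix ι ι ℝ) (Q : κ → Matrix ι ι ℝ) (hJ : J.IsSymm) (hP : P.PosSemidef)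
    (hQ : ∀ l, (Q l).PosSemidef) {k : ℕ} (u : Fin k → ℝ) (hu : ∀ j, 0 < u j) (hinj : Function.Injective u)
    (v : Fin k → ι → ℝ) (hker : ∀ j, (J + ((u j) ^ a)⁻¹ • P + ∑ l, (u j) ^ (b l) • Q l) *ᵥ v j = 0)
    (s : ℝ) (hs : 0 < s) (hsu : ∀ j, s ≠ u j)
    (hstar : ∀ j, 0 ≤ (s - u j) * (-((a : ℝ) * ((u j) ^ a)⁻¹ * (v j ⬝ᵥ (P *ᵥ v j)))
        + ∑ l, (b l : ℝ) * (u j) ^ (b l) * (v j ⬝ᵥ (Q l *ᵥ v j))))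
    (hnd : ∀ j, ¬ (J *ᵥ v j = 0 ∧ P *ᵥ v j = 0 ∧ ∀ l, Q l *ᵥ v j = 0))
    (c : Fin k → ℝ) (hc : c ≠ 0) :
    0 < (∑ j, c j • v j) ⬝ᵥ ((J + (s ^ a)⁻¹ • P + ∑ l, s ^ (b l) • Q l) *ᵥ ∑ j, c j • v j) := by
  classical
  have hna : ∀ l, n l + 2 ≤ a := fun l => by have := hnb l; have := hb l; omega
  have hPs : P.IsSymm := Matrix.isHermitian_iff_isSymm.1 hP.1
  have hQs : ∀ l, (Q l).IsSymm := fun l => Matrix.isHermitian_iff_isSymm.1 (hQ l).1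
  have hw : ∀ j, 0 < ((u j) ^ a)⁻¹ := fun j => inv_pos.2 (pow_pos (hu j) a)
  have ht : 0 < (s ^ a)⁻¹ := inv_pos.2 (pow_pos hs a)
  have hC : ∀ l, 0 < ∫ ρ in Ioi (0:ℝ), ρ ^ (n l) / (1 + ρ ^ a) :=
    fun l => VLawStieltjes.stieltjesConst_pos (hna l)
  -- the Stieltjes weights of the nodes are pairwise distinct and differ from the target weight
  have hwinj : Function.Injective fun j => ((u j) ^ a)⁻¹ := by
    intro i j h
    exact hinj ((pow_left_inj₀ (hu i).le (hu j).le ha.ne').1 (inv_injective h))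
  have hD : ∀ j, (s ^ a)⁻¹ - ((u j) ^ a)⁻¹ ≠ 0 := by
    intro j h
    exact hsu j ((pow_left_inj₀ hs.le (hu j).le ha.ne').1 (inv_injective (sub_eq_zero.1 h)))
  -- Step 1: bilinear expansion and the entrywise Stieltjes form
  rw [quadForm_sum_smul]
  have hentry : ∀ i j, v i ⬝ᵥ ((J + (s ^ a)⁻¹ • P + ∑ l, s ^ (b l) • Q l) *ᵥ v j)
      = (∑ l, (v i ⬝ᵥ (Q l *ᵥ v j)) * (((s ^ a)⁻¹ - ((u i) ^ a)⁻¹) * ((s ^ a)⁻¹ - ((u j) ^ a)⁻¹)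
          * (∫ ρ in Ioi (0:ℝ), ρ ^ (n l) / (((u i) ^ a)⁻¹ + ρ ^ a)
              * ((((u j) ^ a)⁻¹ + ρ ^ a)⁻¹ * ((s ^ a)⁻¹ + ρ ^ a)⁻¹))
          / ∫ ρ in Ioi (0:ℝ), ρ ^ (n l) / (1 + ρ ^ a)))
        + if i = j then ((s ^ a)⁻¹ - ((u i) ^ a)⁻¹) * (v i ⬝ᵥ (P *ᵥ v i)
            - ∑ l, ((b l : ℝ) / a) * (u i) ^ (a + b l) * (v i ⬝ᵥ (Q l *ᵥ v i))) else 0 := by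
    intro i j
    by_cases hij : i = j
    · subst hij
      rw [if_pos rfl]
      exact entry_diag hnb hb J P Q (hu i) hs (hker i)
    · rw [if_neg hij, add_zero]
      exact entry_offdiag ha hnb hb hJ hPs hQs (hu i) (hu j) hs (fun h => hij (hinj h)) (hker i) (hker j)
  simp_rw [hentry]
  rw [rearrange c (fun i => (s ^ a)⁻¹ - ((u i) ^ a)⁻¹)
    (fun i => ((s ^ a)⁻¹ - ((u i) ^ a)⁻¹) * (v i ⬝ᵥ (P *ᵥ v i)
      - ∑ l, ((b l : ℝ) / a) * (u i) ^ (a + b l) * (v i ⬝ᵥ (Q l *ᵥ v i))))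
    (fun l i j => v i ⬝ᵥ (Q l *ᵥ v j))
    (fun l i j => ∫ ρ in Ioi (0:ℝ), ρ ^ (n l) / (((u i) ^ a)⁻¹ + ρ ^ a)
        * ((((u j) ^ a)⁻¹ + ρ ^ a)⁻¹ * ((s ^ a)⁻¹ + ρ ^ a)⁻¹))
    (fun l => ∫ ρ in Ioi (0:ℝ), ρ ^ (n l) / (1 + ρ ^ a))]
  -- Step 2: each Gram block is the integral of a nonnegative continuous function
  set e : Fin k → ℝ := fun i => c i * ((s ^ a)⁻¹ - ((u i) ^ a)⁻¹) with he_def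
  have hblock : ∀ l, ∑ i, ∑ j, c i * ((s ^ a)⁻¹ - ((u i) ^ a)⁻¹) * (c j * ((s ^ a)⁻¹ - ((u j) ^ a)⁻¹))
      * (v i ⬝ᵥ (Q l *ᵥ v j))
      * (∫ ρ in Ioi (0:ℝ), ρ ^ (n l) / (((u i) ^ a)⁻¹ + ρ ^ a) * ((((u j) ^ a)⁻¹ + ρ ^ a)⁻¹ * ((s ^ a)⁻¹ + ρ ^ a)⁻¹))
      = ∫ ρ in Ioi (0:ℝ), ∑ i, ∑ j, e i * e j * (v i ⬝ᵥ (Q l *ᵥ v j))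
        * (ρ ^ (n l) / (((u i) ^ a)⁻¹ + ρ ^ a) * ((((u j) ^ a)⁻¹ + ρ ^ a)⁻¹ * ((s ^ a)⁻¹ + ρ ^ a)⁻¹)) :=
    fun l => (integral_quadForm (hna l) (fun i => ((u i) ^ a)⁻¹) hw ht (Q l) v e).symm
  -- pointwise nonnegativity of the kernel integrands
  have hnonneg : ∀ l (ρ : ℝ), 0 < ρ → 0 ≤ ∑ i, ∑ j, e i * e j * (v i ⬝ᵥ (Q l *ᵥ v j))
      * (ρ ^ (n l) / (((u i) ^ a)⁻¹ + ρ ^ a) * ((((u j) ^ a)⁻¹ + ρ ^ a)⁻¹ * ((s ^ a)⁻¹ + ρ ^ a)⁻¹)) := by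
    intro l ρ hρ
    rw [quadForm_y]
    refine mul_nonneg (mul_nonneg (pow_nonneg hρ.le _) (VLawStieltjes.inv_den_le ht hρ.le).1) ?_
    have h := (hQ l).dotProduct_mulVec_nonneg (∑ j, (e j * (((u j) ^ a)⁻¹ + ρ ^ a)⁻¹) • v j)
    rwa [star_trivial] at h
  have hint_nonneg : ∀ l, 0 ≤ ∫ ρ in Ioi (0:ℝ), ∑ i, ∑ j, e i * e j * (v i ⬝ᵥ (Q l *ᵥ v j))
      * (ρ ^ (n l) / (((u i) ^ a)⁻¹ + ρ ^ a) * ((((u j) ^ a)⁻¹ + ρ ^ a)⁻¹ * ((s ^ a)⁻¹ + ρ ^ a)⁻¹)) :=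
    fun l => setIntegral_nonneg measurableSet_Ioi fun ρ hρ => hnonneg l ρ hρ
  -- Step 3: the slack terms are nonnegative (STAR)
  have hslack_eq : ∀ i, v i ⬝ᵥ (P *ᵥ v i) - ∑ l, ((b l : ℝ) / a) * (u i) ^ (a + b l) * (v i ⬝ᵥ (Q l *ᵥ v i))
      = -((u i) ^ a / a) * (-((a : ℝ) * ((u i) ^ a)⁻¹ * (v i ⬝ᵥ (P *ᵥ v i)))
          + ∑ l, (b l : ℝ) * (u i) ^ (b l) * (v i ⬝ᵥ (Q l *ᵥ v i))) := by
    intro i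
    have ha0 : (a : ℝ) ≠ 0 := by exact_mod_cast ha.ne'
    have hu0 : (u i) ^ a ≠ 0 := (pow_pos (hu i) a).ne'
    rw [mul_add, Finset.mul_sum, sub_eq_add_neg, ← Finset.sum_neg_distrib]
    congr 1
    · field_simp
    · refine Finset.sum_congr rfl fun l _ => ?_
      rw [pow_add]
      field_simp
  have hslack : ∀ i, 0 ≤ ((s ^ a)⁻¹ - ((u i) ^ a)⁻¹) * (v i ⬝ᵥ (P *ᵥ v i)
      - ∑ l, ((b l : ℝ) / a) * (u i) ^ (a + b l) * (v i ⬝ᵥ (Q l *ᵥ v i))) := by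
    intro i
    rw [hslack_eq]
    have h := weight_sign (a := a) hs (hu i) (hstar i)
    have hpos : 0 ≤ (u i) ^ a / a := div_nonneg (pow_nonneg (hu i).le a) (Nat.cast_nonneg a)
    have : ((s ^ a)⁻¹ - ((u i) ^ a)⁻¹) * (-((u i) ^ a / a) * (-((a : ℝ) * ((u i) ^ a)⁻¹ * (v i ⬝ᵥ (P *ᵥ v i)))
          + ∑ l, (b l : ℝ) * (u i) ^ (b l) * (v i ⬝ᵥ (Q l *ᵥ v i))))
        = ((u i) ^ a / a) * ((((u i) ^ a)⁻¹ - (s ^ a)⁻¹) * (-((a : ℝ) * ((u i) ^ a)⁻¹ * (v i ⬝ᵥ (P *ᵥ v i)))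
          + ∑ l, (b l : ℝ) * (u i) ^ (b l) * (v i ⬝ᵥ (Q l *ᵥ v i)))) := by ring
    rw [this]
    exact mul_nonneg hpos h
  -- Step 4: nonnegativity of the whole form, and strictness by contradiction
  have hAterm : ∀ l, 0 ≤ (∫ ρ in Ioi (0:ℝ), ρ ^ (n l) / (1 + ρ ^ a))⁻¹ *
      ∑ i, ∑ j, c i * ((s ^ a)⁻¹ - ((u i) ^ a)⁻¹) * (c j * ((s ^ a)⁻¹ - ((u j) ^ a)⁻¹))
        * (v i ⬝ᵥ (Q l *ᵥ v j))
        * (∫ ρ in Ioi (0:ℝ), ρ ^ (n l) / (((u i) ^ a)⁻¹ + ρ ^ a)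
            * ((((u j) ^ a)⁻¹ + ρ ^ a)⁻¹ * ((s ^ a)⁻¹ + ρ ^ a)⁻¹)) := fun l => by
    rw [hblock l]; exact mul_nonneg (inv_nonneg.2 (hC l).le) (hint_nonneg l)
  have hA : 0 ≤ ∑ l, (∫ ρ in Ioi (0:ℝ), ρ ^ (n l) / (1 + ρ ^ a))⁻¹ *
      ∑ i, ∑ j, c i * ((s ^ a)⁻¹ - ((u i) ^ a)⁻¹) * (c j * ((s ^ a)⁻¹ - ((u j) ^ a)⁻¹))
        * (v i ⬝ᵥ (Q l *ᵥ v j))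
        * (∫ ρ in Ioi (0:ℝ), ρ ^ (n l) / (((u i) ^ a)⁻¹ + ρ ^ a)
            * ((((u j) ^ a)⁻¹ + ρ ^ a)⁻¹ * ((s ^ a)⁻¹ + ρ ^ a)⁻¹)) :=
    Finset.sum_nonneg fun l _ => hAterm l
  have hB : 0 ≤ ∑ i, c i ^ 2 * (((s ^ a)⁻¹ - ((u i) ^ a)⁻¹) * (v i ⬝ᵥ (P *ᵥ v i)
      - ∑ l, ((b l : ℝ) / a) * (u i) ^ (a + b l) * (v i ⬝ᵥ (Q l *ᵥ v i)))) :=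
    Finset.sum_nonneg fun i _ => mul_nonneg (sq_nonneg _) (hslack i)
  refine lt_of_le_of_ne (add_nonneg hA hB) fun hzero => ?_
  -- both parts vanish
  have hA0 := le_antisymm (by linarith) hA
  have hB0 := le_antisymm (by linarith) hB
  -- a nonzero coefficient
  obtain ⟨i₀, hi₀⟩ := Function.ne_iff.1 hc
  have he₀ : e i₀ ≠ 0 := mul_ne_zero hi₀ (hD i₀)
  -- every `Q l` kills `v i₀`
  have hQv : ∀ l, Q l *ᵥ v i₀ = 0 := by
    intro l
    have hl0 := (Finset.sum_eq_zero_iff_of_nonneg fun l _ => hAterm l).1 hA0 l (Finset.mem_univ l)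
    rw [hblock l, mul_eq_zero] at hl0
    have hI : ∫ ρ in Ioi (0:ℝ), ∑ i, ∑ j, e i * e j * (v i ⬝ᵥ (Q l *ᵥ v j))
        * (ρ ^ (n l) / (((u i) ^ a)⁻¹ + ρ ^ a) * ((((u j) ^ a)⁻¹ + ρ ^ a)⁻¹ * ((s ^ a)⁻¹ + ρ ^ a)⁻¹)) = 0 :=
      hl0.resolve_left (inv_ne_zero (hC l).ne')
    have hvan := eq_zero_of_integral_eq_zero
      (continuousOn_kernelSum (n l) a hw ht (fun i j => v i ⬝ᵥ (Q l *ᵥ v j)) e) (hnonneg l)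
      (integrable_finsetSum _ fun i _ => integrable_finsetSum _ fun j _ =>
        integrableOn_kernel_term (hna l) (hw i) (hw j) ht _) hI
    -- `Q l y_ρ = 0` for every `ρ > 0`
    have hQy : ∀ ρ : ℝ, 0 < ρ → ∑ i, (((u i) ^ a)⁻¹ + ρ ^ a)⁻¹ • (e i • (Q l *ᵥ v i)) = 0 := by
      intro ρ hρ
      have h0 := hvan ρ hρ
      rw [quadForm_y, mul_eq_zero] at h0
      have h1 : (∑ i, (e i * (((u i) ^ a)⁻¹ + ρ ^ a)⁻¹) • v i)
          ⬝ᵥ (Q l *ᵥ ∑ j, (e j * (((u j) ^ a)⁻¹ + ρ ^ a)⁻¹) • v j) = 0 :=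
        h0.resolve_left (mul_ne_zero (pow_pos hρ _).ne' (inv_ne_zero (VLawStieltjes.den_pos ht a hρ.le).ne'))
      have h2 := ((hQ l).dotProduct_mulVec_zero_iff (∑ j, (e j * (((u j) ^ a)⁻¹ + ρ ^ a)⁻¹) • v j)).1
        (by rwa [star_trivial])
      rw [mulVec_sum] at h2
      rw [← h2]
      refine Finset.sum_congr rfl fun i _ => ?_
      rw [mulVec_smul, smul_smul, mul_comm]
    have hβ := eq_zero_of_sum_inv_smul_eq_zero ha (fun i => ((u i) ^ a)⁻¹) hw hwinj
      (fun i => e i • (Q l *ᵥ v i)) hQy i₀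
    exact (smul_eq_zero.1 hβ).resolve_left he₀
  -- the slack at `i₀` vanishes, hence `P v i₀ = 0`
  have hPv : P *ᵥ v i₀ = 0 := by
    have hs0 := (Finset.sum_eq_zero_iff_of_nonneg fun i _ => mul_nonneg (sq_nonneg (c i)) (hslack i)).1
      hB0 i₀ (Finset.mem_univ i₀)
    have hQ0 : ∀ l, v i₀ ⬝ᵥ (Q l *ᵥ v i₀) = 0 := fun l => by rw [hQv l, dotProduct_zero]
    simp_rw [hQ0, mul_zero, Finset.sum_const_zero, sub_zero] at hs0
    rw [mul_eq_zero, mul_eq_zero] at hs0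
    rcases hs0 with h | h | h
    · exact absurd (pow_eq_zero_iff two_ne_zero |>.1 h) hi₀
    · exact absurd h (hD i₀)
    · have := (hP.dotProduct_mulVec_zero_iff (v i₀)).1 (by rwa [star_trivial])
      exact this
  -- the kernel relation then gives `J v i₀ = 0`: contradiction with nondegeneracy
  have hJv : J *ᵥ v i₀ = 0 := by
    have h := hker i₀
    rw [add_mulVec, add_mulVec, smul_mulVec, hPv, smul_zero, add_zero, Matrix.sum_mulVec,
      Finset.sum_eq_zero (fun l _ => by rw [smul_mulVec, hQv l, smul_zero]), add_zero] at h
    exact h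
  exact hnd i₀ ⟨hJv, hPv, hQv⟩

end Core

end VLawCore

end Summit.ValiantsHypothesis.ValiantsHypothesis.Theorems.LacunarySymmetroidMatrixDescartes
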